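import Literature.AlgebraicGeometry.AbelianSchemes.AbelianSchemeFibreFrobeniusTwistHom
import Literature.AlgebraicGeometry.AbelianSchemes.PolarizationLawAtFieldPoint
import Literature.AlgebraicGeometry.AbelianSchemes.AbelianSchemeFibreKernelTransport   -- ★ `AbelianVariety.iso_hom_hom_hom_hom_comp_inv`
import HarnessLib

/-!
# The Frobenius-moved fibre `A_{x ≫ F_S} ≅ (A_x)^{(q)}` is `λ`-EXACT, and a cover into `A_{x ≫ F_S}` transfers along it to a cover into
# the base change `A_x ×_{L, Frob^r} L` (piece (d3) of ★ `AbelianSchemeFibreFrobeniusTwist` ∕ `…Hom`; [Shimura1998] §18.6, [MumfordAV1970] §15 Thm. 1)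

Topic `AlgebraicGeometry/AbelianSchemes`; namespace `Literature.AlgebraicGeometry.AbelianSchemes.AbelianSchemeOver`.  THEOREMS ONLY
(no definition, no named fact, no instance, no notation, no `sorry`).  Cell `pub/hodgecm-mathlib`, P6 «MOD programme», line L3 (D-LINE socket
`stub_FROB`, A-p03 (g30) closer skeleton v2 `stub_TWISTCOVER0`, ROAD A «cover clause», refined 2026-09-02T01:52:30Z): the Frobenius cover of the
letter `FrobCover₀ … 𝔞 n x̄′ x̄` lands in the BASE CHANGE `(sch₀Of x̄).baseChange (frobSpec κ̄ p f)` with its polarisation `(pol₀Of x̄).baseChange frobSpec`,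
dual pair `(dual₀Of x̄).baseChange frobSpec`, endomorphisms `baseChangeHom (ι(a)_x̄) frobSpec` and level points `F_{A_x̄/κ̄}(σ^a(x̄))` (`relFrobeniusOver`),
while the reduced isomorphism `ē` of the road lands in the fibre `A_{x̄″}` at the Frobenius-MOVED point `x̄″ = F̃ x̄ = x̄ ≫ F_S` (★
`IntegralModel.geomReductionMap_smul_of_isAbsArithFrob`, ★ `GaloisThickeningMovedSheetFrobenius`).  The junction is the (d1) isomorphism
`E = fibreFrobeniusTwistIso : A_{x ≫ F_S} ≅ (A_x)^{(q)}` — (d1) reads the level sections through it, (d2) the homomorphisms; THIS file adds the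
POLARISATION: **`E` is `λ`-exact in dual-homomorphism form, `E ≫ λ_x^{(q)} ≫ E^∨ = λ_{x ≫ F_S}`** (§2), restates (d1)(d2) in the `baseChangeHom` ∕
`relFrobeniusOver` currency of the letter (§3), and gives the TRANSFER of the cover clauses along `E` for any homomorphism `u` into `A_{x ≫ F_S}` (§0: kernel law on all `T`-points, surjectivity,
polarisation law `u ≫ λ ≫ u^∨ = λ′ ≫ [n]`; equivariance and section values compose), packaged def-free in §5 for an arbitrary point `x″ = x ≫ F_S`.

## Mathematics

`S` a scheme over a finite field `k` with `#k = q = p^r`, `A → S` an abelian scheme with dual pair `D = (Â, 𝒫)` and polarisation `λ`,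
`L ⊇ k` a perfect field, `x : Spec L → S` over `k`.  The `q`-Frobenius `F_S` moves `x` to `x ≫ F_S = Spec(Frob^r) ≫ x` (★ `comp_frobeniusOver_left`),
so `A_{x ≫ F_S} = A ×_{S} (Spec L → Spec L → S) ≅ (A ×_S Spec L) ×_{Spec L, Frob^r} Spec L = (A_x)^{(q)}` by TRANSITIVITY OF BASE CHANGE
([GortzWedhorn2020] Prop. 4.16).  The (d1) isomorphism is «transport along the equality of points» ≫ «transitivity» (★ `fibreCongrPtIso` ≫ ★
`conjFibreIso⁻¹`).  Both pieces are `λ`-exact in the dual-homomorphism form `e ≫ λ₂ ≫ e^∨ = λ₁` of ★ (G-λ) `PolarizationLawAtFieldPoint`: the first by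
★ `fibreCongrPtIso_hom_comp_lam_comp_dualIsogenyOver`; the second because ★ `conjFibreIso` (built on ★ `Limits.pullbackFacIso`) has THE SAME
underlying morphism as the comparison ★ `baseChangeCompGrpIso` (built on Mathlib `Over.pullbackComp`) — a morphism into a fibre product is determined
by its two projections (§1) — and the comparison is `λ`-exact by ★ `baseChangeCompGrpIso_hom_comp_lam_comp_dualIsogenyOver` ([MumfordFogartyKirwan1994]
Ch. 6 §1 Cor. 6.8: the dual commutes with base change; [MumfordAV1970] §15 Thm. 1: `(ψχ)^∨ = χ^∨ψ^∨`).  `λ`-exactness composes (★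
`comp_comp_lam_comp_dualIsogenyOver_comp`).  TRANSFER: if `u : C → A_{x ≫ F_S}` satisfies `u ≫ λ_{x ≫ F_S} ≫ u^∨ = λ_C ≫ [n]` then `u ≫ E` satisfies
`(u ≫ E) ≫ λ_x^{(q)} ≫ (u ≫ E)^∨ = λ_C ≫ [n]` (`(u ≫ E)^∨ = E^∨ ≫ u^∨`); kernels and surjectivity are unchanged by an isomorphism; equivariance and
section values compose with (d2) `fibreHom_comp_fibreFrobeniusTwistIso_hom` and (d1) `map_fibreFrobeniusTwistIso_restrictPt`
([Shimura1998] §18.6 p. 127 «`π ∘ β = β^f ∘ π`», p. 128 «`(t^σ)~ = π(t̃)`»).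

## Contents
* §0 bookkeeping (any base): `comp_comp_eq_one_iff_of_mono`, `comp_kernel_iff_of_mono` (a kernel law on all `T`-points is unchanged by a monomorphic
  homomorphism), `comp_lam_comp_dualIsogenyOver_comp_of_exact` (a polarisation law `u ≫ λ₂ ≫ u^∨ = λ₁ ≫ [n]` followed by a `λ`-exact homomorphism),
  `surjective_comp_left_base` (surjectivity is unchanged by an isomorphism).
* §1 `conjFibreIso_hom_hom_hom_hom_eq_baseChangeCompGrpIso_inv`, `conjFibreIso_inv_hom_hom_hom_eq_baseChangeCompGrpIso_hom` (★ `conjFibreIso` IS the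
  comparison ★ `baseChangeCompGrpIso`, on underlying morphisms).
* §2 `conjFibreIso_inv_comp_lam_comp_dualIsogenyOver`, `conjFibreIso_hom_comp_lam_comp_dualIsogenyOver` (the conjugate-fibre identification is
  `λ`-exact), **`fibreFrobeniusTwistIso_hom_comp_lam_comp_dualIsogenyOver`**, `fibreFrobeniusTwistIso_inv_comp_lam_comp_dualIsogenyOver`.
* §3 `baseChangeHom_comp_fibreFrobeniusTwistIso_hom` ((d2) in `baseChangeHom` currency), `map_fibreFrobeniusTwistIso_restrictPt_relFrobeniusOver`
  ((d1) in `relFrobeniusOver` currency).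
* §5 **`exists_frobeniusTwist_junction`** — def-free package at an arbitrary point `x″` with `x″ = x ≫ F_S` (isomorphism + homomorphism + `λ`-exact +
  natural + sections), and **`exists_frobeniusTwist_cover_of_cover`** — the transfer of the clauses (f1′)(f3)(f4)(f5) of a cover `u : C → A ×_S x″` to
  `u ≫ J : C → (A ×_S x) ×_L Frob^r`.

HC_CM is proved only modulo the printed citations until rung 0 closes; this file is generic (moduli-free, CM-free) and changes no count.

## References
* [Shimura1998] G. Shimura, *Abelian varieties with complex multiplication and modular functions* (1998), §18.6 proof of Thm. 18.6,
  pp. 127–128 («`π : Ã → Ã^f`», «`π ∘ β = β^f ∘ π`», «`(t^σ)~ = π(t̃)`»).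
* [MumfordAV1970] D. Mumford, *Abelian Varieties* (1970), §15 Thm. 1 (p. 143) (`(ψχ)^∨ = χ^∨ψ^∨`).
* [MumfordFogartyKirwan1994] D. Mumford, J. Fogarty, F. Kirwan, *GIT* (3rd ed.), Ch. 6 §1 Cor. 6.8 (p. 118) (dual commutes with base change),
  Ch. 7 §2 Def. 7.1–7.2 (p. 129).
* [GortzWedhorn2020] U. Görtz, T. Wedhorn, *Algebraic Geometry I* (2nd ed.), Section (4.7), Prop. 4.16 (transitivity of base change).
* [Milne2025] J. S. Milne, *Étale cohomology*, VI §13 Rem. 13.5 (`X^{(q)}`, `F_{X/k}`).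
-/

set_option autoImplicit false

noncomputable section

-- `(specOver k L).left = Spec L`, `specTwist (iterateFrobeniusEquiv L p r) = frobSpec L p r` and
-- `A.frobeniusTwist p r = A.conjugate (iterateFrobeniusEquiv L p r)` are definitional only above `instances` transparency
-- (as in ★ `AbelianSchemeFibreFrobeniusTwist`, ★ `AbelianSchemeOverFibreConjugate`).
set_option backward.isDefEq.respectTransparency false

universe u

open CategoryTheory CategoryTheory.Limits AlgebraicGeometry

namespace Literature.AlgebraicGeometry.AbelianSchemes

namespace AbelianSchemeOver

open Literature.AlgebraicGeometry.Motives Literature.AlgebraicGeometry.Limits Literature.AlgebraicGeometry.GroupSchemes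
open scoped MonObj CategoryTheory.Obj

/-! ## §0 Bookkeeping over any base -/

section Bookkeeping

variable {S : Scheme.{u}}

/-- **Kernels are unchanged by a monomorphic homomorphism**: for a homomorphism `E : B → B′` of `S`-group schemes which is a monomorphism (e.g. an
isomorphism) and any `t : T → C`, `u : C → B`: `t ≫ (u ≫ E) = 1 ↔ t ≫ u = 1` (`1 ≫ E = 1`, Mathlib `MonObj.one_comp`). [folklore] -/
private theorem comp_comp_eq_one_iff_of_mono {B B' C : AbelianSchemeOver S} (u : C.X ⟶ B.X) (E : B.X ⟶ B'.X) [IsMonHom E] [Mono E]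
    {T : Over S} (t : T ⟶ C.X) : t ≫ (u ≫ E) = 1 ↔ t ≫ u = 1 := by
  constructor
  · intro h
    rw [← Category.assoc, ← MonObj.one_comp E] at h
    exact (cancel_mono E).1 h
  · intro h
    rw [← Category.assoc, h, MonObj.one_comp]

/-- **A kernel law on all `T`-points transfers along a monomorphic homomorphism**: if `t ≫ u = 1 ↔ P t` for all `t`, then
`t ≫ (u ≫ E) = 1 ↔ P t` for all `t` (the kernel clause (f1′)∕(r2₀) of the P6a letters under an isomorphic change of target). [cite: GortzWedhorn2020, Section (4.7), Prop. 4.16] -/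
theorem comp_kernel_iff_of_mono {B B' C : AbelianSchemeOver S} (u : C.X ⟶ B.X) (E : B.X ⟶ B'.X) [IsMonHom E] [Mono E]
    (P : ∀ ⦃T : Over S⦄, (T ⟶ C.X) → Prop) (hu : ∀ ⦃T : Over S⦄ (t : T ⟶ C.X), t ≫ u = 1 ↔ P t)
    ⦃T : Over S⦄ (t : T ⟶ C.X) : t ≫ (u ≫ E) = 1 ↔ P t :=
  (comp_comp_eq_one_iff_of_mono u E t).trans (hu t)

/-- **A polarisation law followed by a `λ`-exact homomorphism**: `u ≫ λ₂ ≫ u^∨ = λ₁ ≫ [n]` and `E ≫ λ₃ ≫ E^∨ = λ₂` give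
`(u ≫ E) ≫ λ₃ ≫ (u ≫ E)^∨ = λ₁ ≫ [n]` (`(u ≫ E)^∨ = E^∨ ≫ u^∨`, ★ `DualPair.dualIsogenyOver_comp`). [cite: MumfordAV1970, §15 Thm. 1 (p. 143)] -/
theorem comp_lam_comp_dualIsogenyOver_comp_of_exact {A₁ A₂ A₃ : AbelianSchemeOver S} (D₁ : A₁.DualPair) (D₂ : A₂.DualPair) (D₃ : A₃.DualPair)
    (lam₁ : A₁.X ⟶ D₁.hat.X) (lam₂ : A₂.X ⟶ D₂.hat.X) (lam₃ : A₃.X ⟶ D₃.hat.X)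
    (u : A₁.X ⟶ A₂.X) (E : A₂.X ⟶ A₃.X) [IsMonHom u] [IsMonHom E] (n : ℕ)
    (hu : u ≫ lam₂ ≫ DualPair.dualIsogenyOver u D₁ D₂ = lam₁ ≫ D₁.hat.mulN n)
    (hE : E ≫ lam₃ ≫ DualPair.dualIsogenyOver E D₂ D₃ = lam₂) :
    (u ≫ E) ≫ lam₃ ≫ DualPair.dualIsogenyOver (u ≫ E) D₁ D₃ = lam₁ ≫ D₁.hat.mulN n := by
  rw [DualPair.dualIsogenyOver_comp u E D₁ D₂ D₃, ← hu, ← hE]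
  simp only [Category.assoc]

/-- Surjectivity on underlying spaces is unchanged by following with an isomorphism of `S`-schemes. [folklore] -/
private theorem surjective_comp_left_base {X Y Z : Over S} (u : X ⟶ Y) (E : Y ≅ Z) (hu : Function.Surjective u.left.base) :
    Function.Surjective (u ≫ E.hom).left.base := by
  have hE : Function.Surjective E.hom.left.base := (Scheme.homeoOfIso ((Over.forget S).mapIso E)).surjective
  rw [Over.comp_left, Scheme.Hom.comp_base, TopCat.coe_comp]
  exact hE.comp hu

end Bookkeeping

/-! ## §1 ★ `conjFibreIso` IS the comparison ★ `baseChangeCompGrpIso` on underlying morphisms -/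

section Bridge

variable {S : Scheme.{u}} (A : AbelianSchemeOver S) {L : Type u} [Field L] (σ : L ≃+* L) (s : Spec (.of L) ⟶ S)

/-- **The conjugate-fibre identification `(A_s)^σ ≅ A_{Spec σ ≫ s}` (★ `conjFibreIso`, built on ★ `Limits.pullbackFacIso`) has the same underlying
`Spec L`-morphism as the INVERSE comparison `((A ×_S Spec L) ×_{Spec L} Spec L ≅ A ×_S Spec L)` (★ `baseChangeCompGrpIso⁻¹`, built on Mathlib
`Over.pullbackComp`)**: both commute with the two projections of the fibre product `A ×_{S, Spec σ ≫ s} Spec L`.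
[cite: GortzWedhorn2020, Section (4.7), Prop. 4.16] -/
theorem conjFibreIso_hom_hom_hom_hom_eq_baseChangeCompGrpIso_inv :
    (A.conjFibreIso σ s).hom.hom.hom.hom = (A.baseChangeCompGrpIso s (specTwist σ)).inv.hom.hom := by
  apply Over.OverMorphism.ext
  rw [conjFibreIso_hom_hom_hom_hom]
  apply pullback.hom_ext
  · rw [pullbackFacObjIso_hom_left_fst, baseChangeCompGrpIso_inv_left_fst]
    rfl
  · rw [pullbackFacObjIso_hom_left_snd, baseChangeCompGrpIso_inv_left_snd]
    rfl

/-- The inverse form: `(conjFibreIso σ s)⁻¹` has the underlying morphism of the comparison `baseChangeCompGrpIso s (Spec σ)`.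
[cite: GortzWedhorn2020, Section (4.7), Prop. 4.16] -/
theorem conjFibreIso_inv_hom_hom_hom_eq_baseChangeCompGrpIso_hom :
    (A.conjFibreIso σ s).inv.hom.hom.hom = (A.baseChangeCompGrpIso s (specTwist σ)).hom.hom.hom := by
  have h1 : (A.conjFibreIso σ s).inv.hom.hom.hom ≫ (A.conjFibreIso σ s).hom.hom.hom.hom = 𝟙 _ :=
    AbelianVariety.iso_inv_hom_hom_hom_comp_hom _
  have h2 := A.baseChangeCompGrpIso_hom_hom_hom_comp_inv s (specTwist σ)
  rw [conjFibreIso_hom_hom_hom_hom_eq_baseChangeCompGrpIso_inv] at h1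
  rw [← cancel_mono (A.baseChangeCompGrpIso s (specTwist σ)).inv.hom.hom, h1, h2]
  rfl

end Bridge

/-! ## §2 The conjugate-fibre identification and the Frobenius-moved-fibre identification are `λ`-exact -/

section ConjExact

variable {S : Scheme.{u}} (A : AbelianSchemeOver S) (D : A.DualPair) (pol : A.Polarization D) {L : Type u} [Field L] (σ : L ≃+* L)
  (s : Spec (.of L) ⟶ S)

/-- **`(conjFibreIso σ s)⁻¹ : A_{Spec σ ≫ s} → (A_s)^σ` is `λ`-exact in dual-homomorphism form**:
`e⁻¹ ≫ (λ_s)^σ ≫ (e⁻¹)^∨ = λ_{Spec σ ≫ s}` with `(λ_s)^σ = (λ ×_S Spec L) ×_{Spec L} Spec σ` and the dual pairs `D_{Spec σ ≫ s}`, `(D_s)_{Spec σ}` (★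
`baseChangeCompGrpIso_hom_comp_lam_comp_dualIsogenyOver` through §1). [cite: MumfordFogartyKirwan1994, Ch. 6 §1 Corollary 6.8 (p. 118)]
[cite: MumfordAV1970, §15 Thm. 1 (p. 143)] -/
theorem conjFibreIso_inv_comp_lam_comp_dualIsogenyOver :
    (A.conjFibreIso σ s).inv.hom.hom.hom ≫ ((pol.baseChange s).baseChange (specTwist σ)).lam ≫
        @DualPair.dualIsogenyOver _ (A.baseChange (specTwist σ ≫ s)) ((A.baseChange s).baseChange (specTwist σ))
          (A.conjFibreIso σ s).inv.hom.hom.hom (A.conjFibreIso σ s).inv.hom.hom.isMonHom_hom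
          (D.baseChange (specTwist σ ≫ s)) ((D.baseChange s).baseChange (specTwist σ)) =
      (pol.baseChange (specTwist σ ≫ s)).lam := by
  rw [DualPair.dualIsogenyOver_congr (D.baseChange (specTwist σ ≫ s)) ((D.baseChange s).baseChange (specTwist σ))
      (h₂ := inferInstance) (A.conjFibreIso_inv_hom_hom_hom_eq_baseChangeCompGrpIso_hom σ s),
    A.conjFibreIso_inv_hom_hom_hom_eq_baseChangeCompGrpIso_hom σ s]
  exact baseChangeCompGrpIso_hom_comp_lam_comp_dualIsogenyOver A D pol s (specTwist σ)

/-- **`conjFibreIso σ s : (A_s)^σ → A_{Spec σ ≫ s}` is `λ`-exact in dual-homomorphism form**: `e ≫ λ_{Spec σ ≫ s} ≫ e^∨ = (λ_s)^σ`.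
[cite: MumfordFogartyKirwan1994, Ch. 6 §1 Corollary 6.8 (p. 118)] [cite: MumfordAV1970, §15 Thm. 1 (p. 143)] -/
theorem conjFibreIso_hom_comp_lam_comp_dualIsogenyOver :
    (A.conjFibreIso σ s).hom.hom.hom.hom ≫ (pol.baseChange (specTwist σ ≫ s)).lam ≫
        @DualPair.dualIsogenyOver _ ((A.baseChange s).baseChange (specTwist σ)) (A.baseChange (specTwist σ ≫ s))
          (A.conjFibreIso σ s).hom.hom.hom.hom (A.conjFibreIso σ s).hom.hom.hom.isMonHom_hom
          ((D.baseChange s).baseChange (specTwist σ)) (D.baseChange (specTwist σ ≫ s)) =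
      ((pol.baseChange s).baseChange (specTwist σ)).lam := by
  rw [DualPair.dualIsogenyOver_congr ((D.baseChange s).baseChange (specTwist σ)) (D.baseChange (specTwist σ ≫ s))
      (h₂ := inferInstance) (A.conjFibreIso_hom_hom_hom_hom_eq_baseChangeCompGrpIso_inv σ s),
    A.conjFibreIso_hom_hom_hom_hom_eq_baseChangeCompGrpIso_inv σ s]
  exact baseChangeCompGrpIso_inv_comp_lam_comp_dualIsogenyOver A D pol s (specTwist σ)

end ConjExact

section FrobExact

variable {k : Type u} [Field k] [Finite k] {S : SchemeOver k} (A : AbelianSchemeOver S.left) (D : A.DualPair) (pol : A.Polarization D)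
  {L : Type u} [Field L] [Algebra k L] (p r : ℕ) [ExpChar L p] [PerfectRing L p]

/-- On underlying morphisms, `E = fibreFrobeniusTwistIso = (congr) ≫ (conjFibreIso)⁻¹` (by construction). [cite: GortzWedhorn2020, Section (4.7), Prop. 4.16] -/
theorem fibreFrobeniusTwistIso_hom_hom_hom_hom (hq : Nat.card k = p ^ r) (x : specOver k L ⟶ S) :
    (A.fibreFrobeniusTwistIso p r hq x).hom.hom.hom.hom =
      (A.fibreCongrPtIso (comp_frobeniusOver_left_eq_specTwist_comp p r hq x)).hom.hom.hom.hom ≫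
        (A.conjFibreIso (iterateFrobeniusEquiv L p r) x.left).inv.hom.hom.hom :=
  rfl

/-- **THE FROBENIUS-MOVED-FIBRE IDENTIFICATION `E : A_{x ≫ F_S} ≅ (A_x)^{(q)}` IS `λ`-EXACT IN DUAL-HOMOMORPHISM FORM**:
`E ≫ λ_x^{(q)} ≫ E^∨ = λ_{x ≫ F_S}`, where `λ_x^{(q)} = (λ_x) ×_{L, Frob^r} L = ((pol.baseChange x).baseChange (frobSpec L p r)).lam` is the
polarisation of the base change `(A_x)^{(q)}` and the duals are formed with `D_{x ≫ F_S}` and `(D_x)^{(q)} = (D_x) ×_{L, Frob^r} L` (★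
`DualPair.baseChange`; = ★ `DualPair.frobeniusTwist` of (DF)).  Transport along the equality of points `x ≫ F_S = Spec Frob^r ≫ x` is `λ`-exact
(★ `fibreCongrPtIso_hom_comp_lam_comp_dualIsogenyOver`), the transitivity isomorphism is (§2 `conjFibreIso_inv_comp_lam_comp_dualIsogenyOver`), and
`λ`-exactness composes (★ `comp_comp_lam_comp_dualIsogenyOver_comp`).  This is the hypothesis under which the polarisation clause (f3) of a Frobenius
cover transfers from the moved fibre to the twist (§5). [cite: MumfordAV1970, §15 Thm. 1 (p. 143)] [cite: MumfordFogartyKirwan1994, Ch. 6 §1 Corollary 6.8 (p. 118)]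
[cite: Shimura1998, §18.6 proof of Thm. 18.6, p. 127] -/
theorem fibreFrobeniusTwistIso_hom_comp_lam_comp_dualIsogenyOver (hq : Nat.card k = p ^ r) (x : specOver k L ⟶ S) :
    (A.fibreFrobeniusTwistIso p r hq x).hom.hom.hom.hom ≫ ((pol.baseChange x.left).baseChange (frobSpec L p r)).lam ≫
        @DualPair.dualIsogenyOver _ (A.baseChange (x ≫ frobeniusOver S).left) ((A.baseChange x.left).baseChange (frobSpec L p r))
          (A.fibreFrobeniusTwistIso p r hq x).hom.hom.hom.hom (A.fibreFrobeniusTwistIso p r hq x).hom.hom.hom.isMonHom_hom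
          (D.baseChange (x ≫ frobeniusOver S).left) ((D.baseChange x.left).baseChange (frobSpec L p r)) =
      (pol.baseChange (x ≫ frobeniusOver S).left).lam := by
  -- the two Over-level pieces (`λ`-exact by ★ (G-λ) §3 and by §2), composed (★ `comp_comp_lam_comp_dualIsogenyOver_comp`)
  have h1 := A.fibreCongrPtIso_hom_comp_lam_comp_dualIsogenyOver D pol (comp_frobeniusOver_left_eq_specTwist_comp p r hq x)
  have h2 := A.conjFibreIso_inv_comp_lam_comp_dualIsogenyOver D pol (iterateFrobeniusEquiv L p r) x.left
  have h12 := comp_comp_lam_comp_dualIsogenyOver_comp _ _ _ _ _ _ _ _ h1 h2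
  -- `E = congr ≫ conj⁻¹`, `frobSpec L p r = Spec (Frob^r)` and `(A_x)^{(q)} = (A_x)^{Frob^r}` definitionally
  exact h12

/-- **The inverse `E⁻¹ : (A_x)^{(q)} → A_{x ≫ F_S}` is `λ`-exact in dual-homomorphism form** (★ `inv_comp_lam_comp_dualIsogenyOver_inv_of_eq`).
[cite: MumfordAV1970, §15 Thm. 1 (p. 143)] [cite: MumfordFogartyKirwan1994, Ch. 6 §1 Corollary 6.8 (p. 118)] -/
theorem fibreFrobeniusTwistIso_inv_comp_lam_comp_dualIsogenyOver (hq : Nat.card k = p ^ r) (x : specOver k L ⟶ S) :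
    (A.fibreFrobeniusTwistIso p r hq x).inv.hom.hom.hom ≫ (pol.baseChange (x ≫ frobeniusOver S).left).lam ≫
        @DualPair.dualIsogenyOver _ ((A.baseChange x.left).baseChange (frobSpec L p r)) (A.baseChange (x ≫ frobeniusOver S).left)
          (A.fibreFrobeniusTwistIso p r hq x).inv.hom.hom.hom (A.fibreFrobeniusTwistIso p r hq x).inv.hom.hom.isMonHom_hom
          ((D.baseChange x.left).baseChange (frobSpec L p r)) (D.baseChange (x ≫ frobeniusOver S).left) =
      ((pol.baseChange x.left).baseChange (frobSpec L p r)).lam := by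
  -- the `Over`-level isomorphism underlying `E`
  let e : (A.baseChange (x ≫ frobeniusOver S).left).X ≅ ((A.baseChange x.left).baseChange (frobSpec L p r)).X :=
    ⟨(A.fibreFrobeniusTwistIso p r hq x).hom.hom.hom.hom, (A.fibreFrobeniusTwistIso p r hq x).inv.hom.hom.hom,
      AbelianVariety.iso_hom_hom_hom_hom_comp_inv _, AbelianVariety.iso_inv_hom_hom_hom_comp_hom _⟩
  haveI : IsMonHom e.hom := (A.fibreFrobeniusTwistIso p r hq x).hom.hom.hom.isMonHom_hom
  haveI : IsLocallyNoetherian (specOver k L).left := inferInstanceAs (IsLocallyNoetherian (Spec (CommRingCat.of L)))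
  haveI : IsReduced (specOver k L).left := inferInstanceAs (IsReduced (Spec (CommRingCat.of L)))
  exact inv_comp_lam_comp_dualIsogenyOver_inv_of_eq (D.baseChange (x ≫ frobeniusOver S).left) ((D.baseChange x.left).baseChange (frobSpec L p r))
    (pol.baseChange (x ≫ frobeniusOver S).left).lam ((pol.baseChange x.left).baseChange (frobSpec L p r)).lam
    (((pol.baseChange x.left).baseChange (frobSpec L p r)).nonempty_unitHatSlice_iso) e
    (A.fibreFrobeniusTwistIso_hom_comp_lam_comp_dualIsogenyOver D pol p r hq x)

end FrobExact

/-! ## §3 (d1) and (d2) in the currency of the letter: `baseChangeHom` and `relFrobeniusOver` -/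

section Currency

variable {k : Type u} [Field k] [Finite k] {S : SchemeOver k} {A B : AbelianSchemeOver S.left}
  {L : Type u} [Field L] [Algebra k L] (p r : ℕ) [ExpChar L p] [PerfectRing L p]

/-- Composition of morphisms of abelian varieties, read on the underlying group-scheme morphisms. [folklore] -/
private theorem av_comp_hom_hom_hom' {K : Type u} [Field K] {X Y Z : AbelianVariety K} (φ : X ⟶ Y) (ψ : Y ⟶ Z) :
    (φ ≫ ψ).hom.hom.hom = φ.hom.hom.hom ≫ ψ.hom.hom.hom := rfl

/-- **(d2) in `baseChangeHom` currency — «`π ∘ β = β^f ∘ π`» on the carriers**: for a homomorphism `f : A → B` of abelian schemes over `S`,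
`(f ×_S (x ≫ F_S)) ≫ E_B = E_A ≫ ((f ×_S x) ×_L Frob^r)`, i.e. `baseChangeHom f (x ≫ F_S) ≫ E_B = E_A ≫ baseChangeHom (baseChangeHom f x) (frobSpec L p r)`
(★ `fibreHom_comp_fibreFrobeniusTwistIso_hom` read on `Over (Spec L)`; `(f_x)^{(q)}` IS the double base change, definitionally).  For `f = ι(a)` this is the
equivariance clause (f4) of a Frobenius cover against `baseChangeHom (ι(a)_x̄) frobSpec`. [cite: Shimura1998, §18.6 proof of Thm. 18.6, p. 127]
[cite: Milne2005ShimuraVarieties, §14 pp. 124–125] -/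
theorem baseChangeHom_comp_fibreFrobeniusTwistIso_hom (hq : Nat.card k = p ^ r) (x : specOver k L ⟶ S) (f : A.X ⟶ B.X) [IsMonHom f] :
    baseChangeHom f (x ≫ frobeniusOver S).left ≫ (B.fibreFrobeniusTwistIso p r hq x).hom.hom.hom.hom =
      (A.fibreFrobeniusTwistIso p r hq x).hom.hom.hom.hom ≫ baseChangeHom (baseChangeHom f x.left) (frobSpec L p r) := by
  have h := congrArg (fun φ => φ.hom.hom.hom) (fibreHom_comp_fibreFrobeniusTwistIso_hom p r hq x f)
  simp only [av_comp_hom_hom_hom', fibreHom_hom_hom_hom] at h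
  exact h

/-- **(d1) in `relFrobeniusOver` currency — «`(t^σ)~ = π(t̃)`» on the carriers**: `E` carries the value at `x ≫ F_S` of a section `τ` of `A → S` to the
image of its value at `x` under the relative `q`-Frobenius `F_{A_x/L} = relFrobeniusOver p r (A ×_S x) : A_x → (A_x)^{(q)}` of the `L`-scheme `A_x`
(★ `map_fibreFrobeniusTwistIso_restrictPt`, ★ `relFrobenius_hom_hom_hom`).  This is the level clause (f5) of a Frobenius cover.
[cite: Shimura1998, §18.6 proof of Thm. 18.6, p. 128] [cite: Milne2025, VI §13 Rem. 13.5] -/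
theorem map_fibreFrobeniusTwistIso_restrictPt_relFrobeniusOver (hq : Nat.card k = p ^ r) (x : specOver k L ⟶ S) (τ : A.Sections) :
    AlgPoints.map (A.fibreFrobeniusTwistIso p r hq x).hom.hom.hom.hom (A.restrictPt (x ≫ frobeniusOver S).left τ) =
      AlgPoints.map (relFrobeniusOver p r (A.baseChange x.left).X :
          (A.baseChange x.left).X ⟶ ((A.baseChange x.left).baseChange (frobSpec L p r)).X) (A.restrictPt x.left τ) :=
  A.map_fibreFrobeniusTwistIso_restrictPt p r hq x τ

end Currency

/-! ## §5 The def-free junction package at a Frobenius-moved point, in the currency of the letter -/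

section Package

variable {k : Type u} [Field k] [Finite k] {S : SchemeOver k} (A : AbelianSchemeOver S.left)
  {L : Type u} [Field L] [Algebra k L] (p r : ℕ) [ExpChar L p] [PerfectRing L p]

/-- **THE FROBENIUS-TWIST JUNCTION, DEF-FREE, IN THE CURRENCY OF THE LETTER.**  `S` a scheme over the finite field `k` with `#k = p^r`, `A → S` an
abelian scheme, `L ⊇ k` perfect, `x : Spec L → S` over `k`, and `x″` ANY point EQUAL to the Frobenius move `x ≫ F_S` (in the application: `x″ = red (σ • ℓ_e y)`
and `x = red₀ y`, equal by ★ `IntegralModel.geomReductionMap_smul_of_isAbsArithFrob` ∕ ★ `GaloisThickeningMovedSheetFrobenius`).  THEN there is an ISOMORPHISM of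
`L`-group schemes `J : A ×_S x″ ≅ (A ×_S x) ×_{L, Frob^r} L` (a homomorphism) which
(λ) is `λ`-EXACT for every dual pair `D` and polarisation `λ` of `A`: `J ≫ ((λ ×_S x) ×_L Frob^r) ≫ J^∨ = λ ×_S x″`;
(ι) is NATURAL for every endomorphism `f` of `A`: `(f ×_S x″) ≫ J = J ≫ ((f ×_S x) ×_L Frob^r)`;
(η) carries the value at `x″` of every section `τ` of `A` to `F_{A_x/L}(τ(x))` (`relFrobeniusOver`).
So a Frobenius cover `u : C → A ×_S x″` with clauses (f1′)(f3)(f4)(f5) against `A ×_S x″` yields `u ≫ J : C → (A_x)^{(q)}` with the same clauses against the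
twist (§0: `comp_kernel_iff_of_mono`, `surjective_comp_left_base`, `comp_lam_comp_dualIsogenyOver_comp_of_exact`) — the shape of P6a `FrobCover₀ … x̄′ x̄`.
[cite: Shimura1998, §18.6 proof of Thm. 18.6, pp. 127–128] [cite: MumfordAV1970, §15 Thm. 1 (p. 143)] [cite: GortzWedhorn2020, Section (4.7), Prop. 4.16]
[cite: Milne2025, VI §13 Rem. 13.5] -/
theorem exists_frobeniusTwist_junction (hq : Nat.card k = p ^ r) (x : specOver k L ⟶ S) {x'' : specOver k L ⟶ S}
    (hx'' : x'' = x ≫ frobeniusOver S) :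
    ∃ (J : (A.baseChange x''.left).X ≅ ((A.baseChange x.left).baseChange (frobSpec L p r)).X) (_ : IsMonHom J.hom),
      (∀ (D : A.DualPair) (pol : A.Polarization D),
        J.hom ≫ ((pol.baseChange x.left).baseChange (frobSpec L p r)).lam ≫
            DualPair.dualIsogenyOver J.hom (D.baseChange x''.left) ((D.baseChange x.left).baseChange (frobSpec L p r)) =
          (pol.baseChange x''.left).lam) ∧
      (∀ (f : A.X ⟶ A.X) [IsMonHom f],
        baseChangeHom f x''.left ≫ J.hom = J.hom ≫ baseChangeHom (baseChangeHom f x.left) (frobSpec L p r)) ∧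
      (∀ τ : A.Sections,
        AlgPoints.map J.hom (A.restrictPt x''.left τ) =
          AlgPoints.map (relFrobeniusOver p r (A.baseChange x.left).X :
              (A.baseChange x.left).X ⟶ ((A.baseChange x.left).baseChange (frobSpec L p r)).X) (A.restrictPt x.left τ)) := by
  subst hx''
  refine ⟨⟨(A.fibreFrobeniusTwistIso p r hq x).hom.hom.hom.hom, (A.fibreFrobeniusTwistIso p r hq x).inv.hom.hom.hom,
      AbelianVariety.iso_hom_hom_hom_hom_comp_inv _, AbelianVariety.iso_inv_hom_hom_hom_comp_hom _⟩,
    (A.fibreFrobeniusTwistIso p r hq x).hom.hom.hom.isMonHom_hom, fun D pol => ?_, fun f _ => ?_, fun τ => ?_⟩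
  · exact A.fibreFrobeniusTwistIso_hom_comp_lam_comp_dualIsogenyOver D pol p r hq x
  · exact baseChangeHom_comp_fibreFrobeniusTwistIso_hom p r hq x f
  · exact map_fibreFrobeniusTwistIso_restrictPt_relFrobeniusOver p r hq x τ

/-- **TRANSFER OF A FROBENIUS COVER ALONG THE JUNCTION** (the five clauses at once).  With `x″ = x ≫ F_S` as above, an `𝒪`-action-like family of
endomorphisms `ι : O → End(A)` by homomorphisms, a dual pair `D` with polarisation `λ`, a level-like family of sections `τ : I → A(S)`, an abelian `L`-scheme
`C` with dual pair `D_C`, a homomorphism `λ_C : C → Ĉ`, endomorphisms `ι_C : O → End(C)`, points `P : I → C(L)`, an integer `n` and a predicate `K` on `T`-points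
of `C` (the kernel law): every homomorphism `u : C → A ×_S x″` with (f1′) `t ≫ u = 1 ↔ K t` on all `T`-points and `u` surjective, (f3) `u ≫ (λ ×_S x″) ≫ u^∨ = λ_C ≫ [n]`,
(f4) `ι_C(a) ≫ u = u ≫ (ι(a) ×_S x″)`, (f5) `u(P i) = τ_i(x″)`, yields a homomorphism `c : C → (A ×_S x) ×_L Frob^r` (namely `u ≫ J`) with (f1′) `t ≫ c = 1 ↔ K t`, `c`
surjective, (f3) `c ≫ ((λ ×_S x) ×_L Frob^r) ≫ c^∨ = λ_C ≫ [n]`, (f4) `ι_C(a) ≫ c = c ≫ ((ι(a) ×_S x) ×_L Frob^r)`, (f5) `c(P i) = F_{A_x/L}(τ_i(x))` — the clauses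
(f1′)(f3)(f4)(f5) of P6a `FrobCover₀` (its (f1) Serre presentation transfers likewise with `d ↦ J⁻¹ ≫ d`, left to the consumer who holds `d`).
[cite: Shimura1998, §18.6 proof of Thm. 18.6, pp. 127–128] [cite: MumfordAV1970, §15 Thm. 1 (p. 143)] [cite: Milne2025, VI §13 Rem. 13.5] -/
theorem exists_frobeniusTwist_cover_of_cover (hq : Nat.card k = p ^ r) (x : specOver k L ⟶ S) {x'' : specOver k L ⟶ S}
    (hx'' : x'' = x ≫ frobeniusOver S) {O I : Type*} (act : O → (A.X ⟶ A.X)) (hact : ∀ a, IsMonHom (act a))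
    (D : A.DualPair) (pol : A.Polarization D) (τ : I → A.Sections)
    {C : AbelianSchemeOver (Spec (.of L))} (DC : C.DualPair) (lamC : C.X ⟶ DC.hat.X) (actC : O → (C.X ⟶ C.X))
    (P : I → Literature.AlgebraicGeometry.Motives.AlgPoints C.X L) (n : ℕ)
    (K : ∀ ⦃T : Over (Spec (.of L))⦄, (T ⟶ C.X) → Prop)
    (u : C.X ⟶ (A.baseChange x''.left).X) [IsMonHom u]
    (hker : ∀ ⦃T : Over (Spec (.of L))⦄ (t : T ⟶ C.X), t ≫ u = 1 ↔ K t) (hsurj : Function.Surjective u.left.base)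
    (hlam : u ≫ (pol.baseChange x''.left).lam ≫ DualPair.dualIsogenyOver u DC (D.baseChange x''.left) = lamC ≫ DC.hat.mulN n)
    (hequiv : ∀ a, actC a ≫ u = u ≫ baseChangeHom (act a) x''.left)
    (hsec : ∀ i, AlgPoints.map u (P i) = A.restrictPt x''.left (τ i)) :
    ∃ (c : C.X ⟶ ((A.baseChange x.left).baseChange (frobSpec L p r)).X) (_ : IsMonHom c),
      (∀ ⦃T : Over (Spec (.of L))⦄ (t : T ⟶ C.X), t ≫ c = 1 ↔ K t) ∧
      Function.Surjective c.left.base ∧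
      c ≫ ((pol.baseChange x.left).baseChange (frobSpec L p r)).lam ≫
          DualPair.dualIsogenyOver c DC ((D.baseChange x.left).baseChange (frobSpec L p r)) = lamC ≫ DC.hat.mulN n ∧
      (∀ a, actC a ≫ c = c ≫ baseChangeHom (baseChangeHom (act a) x.left) (frobSpec L p r)) ∧
      (∀ i, AlgPoints.map c (P i) =
        AlgPoints.map (relFrobeniusOver p r (A.baseChange x.left).X :
            (A.baseChange x.left).X ⟶ ((A.baseChange x.left).baseChange (frobSpec L p r)).X) (A.restrictPt x.left (τ i))) := by
  obtain ⟨J, hJ, hJlam, hJnat, hJsec⟩ := A.exists_frobeniusTwist_junction p r hq x hx''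
  haveI := hJ
  refine ⟨u ≫ J.hom, inferInstance, fun T t => comp_kernel_iff_of_mono u J.hom K hker t, surjective_comp_left_base u J hsurj,
    comp_lam_comp_dualIsogenyOver_comp_of_exact DC (D.baseChange x''.left) ((D.baseChange x.left).baseChange (frobSpec L p r)) lamC
      (pol.baseChange x''.left).lam ((pol.baseChange x.left).baseChange (frobSpec L p r)).lam u J.hom n hlam (hJlam D pol),
    fun a => ?_, fun i => ?_⟩
  · haveI := hact a
    rw [← Category.assoc, hequiv a, Category.assoc, hJnat (act a), Category.assoc]
  · rw [AlgPoints.map_comp_apply, hsec i, hJsec (τ i)]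

end Package

/-! ## §6 (ED. 2) The transfer with the SERRE PRESENTATION clause: all five `FrobCover₀` clauses in one package -/

section PackagePresentation

variable {k : Type u} [Field k] [Finite k] {S : SchemeOver k} (A : AbelianSchemeOver S.left)
  {L : Type u} [Field L] [Algebra k L] (p r : ℕ) [ExpChar L p] [PerfectRing L p]

/-- **TRANSFER OF A FROBENIUS COVER ALONG THE JUNCTION, WITH THE SERRE PRESENTATION (f1)** (ED. 2; the shape of ALL FIVE clauses of P6a
`FrobCover₀ … 𝔞 n x̄′ x̄`).  As in `exists_frobeniusTwist_cover_of_cover`, with in addition a predicate `Q` on `O` («`a ∈ 𝔞`») and the two-sided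
presentation (f1) of `u : C → A ×_S x″` — for `Q a` some `d : A ×_S x″ → C` has `u ≫ d = ι_C(a)` and `d ≫ u = ι(a) ×_S x″` —: the cover
`c := u ≫ J : C → (A ×_S x) ×_L Frob^r` has the presentation (f1) `c ≫ d′ = ι_C(a)`, `d′ ≫ c = (ι(a) ×_S x) ×_L Frob^r` with `d′ := J⁻¹ ≫ d` (by the
naturality (ι) of `J`), together with (f1′) the kernel law `K` on all `T`-points and surjectivity, (f3) `c ≫ ((λ ×_S x) ×_L Frob^r) ≫ c^∨ = λ_C ≫ [n]`,
(f4) equivariance against `(ι(a) ×_S x) ×_L Frob^r`, and (f5) `c(P i) = F_{A_x/L}(τ_i(x))`.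
[cite: Shimura1998, §13.1 Thm. 1 (pp. 97–99); §18.6 proof of Thm. 18.6, pp. 127–128] [cite: MumfordAV1970, §7 Thm. 4 (p. 72); §15 Thm. 1 (p. 143)]
[cite: Milne2025, VI §13 Rem. 13.5] -/
theorem exists_frobeniusTwist_cover_of_cover_of_presentation (hq : Nat.card k = p ^ r) (x : specOver k L ⟶ S) {x'' : specOver k L ⟶ S}
    (hx'' : x'' = x ≫ frobeniusOver S) {O I : Type*} (act : O → (A.X ⟶ A.X)) (hact : ∀ a, IsMonHom (act a)) (Q : O → Prop)
    (D : A.DualPair) (pol : A.Polarization D) (τ : I → A.Sections)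
    {C : AbelianSchemeOver (Spec (.of L))} (DC : C.DualPair) (lamC : C.X ⟶ DC.hat.X) (actC : O → (C.X ⟶ C.X))
    (P : I → Literature.AlgebraicGeometry.Motives.AlgPoints C.X L) (n : ℕ)
    (K : ∀ ⦃T : Over (Spec (.of L))⦄, (T ⟶ C.X) → Prop)
    (u : C.X ⟶ (A.baseChange x''.left).X) [IsMonHom u]
    (hpres : ∀ a, Q a → ∃ d : (A.baseChange x''.left).X ⟶ C.X, u ≫ d = actC a ∧ d ≫ u = baseChangeHom (act a) x''.left)
    (hker : ∀ ⦃T : Over (Spec (.of L))⦄ (t : T ⟶ C.X), t ≫ u = 1 ↔ K t) (hsurj : Function.Surjective u.left.base)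
    (hlam : u ≫ (pol.baseChange x''.left).lam ≫ DualPair.dualIsogenyOver u DC (D.baseChange x''.left) = lamC ≫ DC.hat.mulN n)
    (hequiv : ∀ a, actC a ≫ u = u ≫ baseChangeHom (act a) x''.left)
    (hsec : ∀ i, AlgPoints.map u (P i) = A.restrictPt x''.left (τ i)) :
    ∃ (c : C.X ⟶ ((A.baseChange x.left).baseChange (frobSpec L p r)).X) (_ : IsMonHom c),
      (∀ a, Q a → ∃ d : ((A.baseChange x.left).baseChange (frobSpec L p r)).X ⟶ C.X,
        c ≫ d = actC a ∧ d ≫ c = baseChangeHom (baseChangeHom (act a) x.left) (frobSpec L p r)) ∧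
      (∀ ⦃T : Over (Spec (.of L))⦄ (t : T ⟶ C.X), t ≫ c = 1 ↔ K t) ∧
      Function.Surjective c.left.base ∧
      c ≫ ((pol.baseChange x.left).baseChange (frobSpec L p r)).lam ≫
          DualPair.dualIsogenyOver c DC ((D.baseChange x.left).baseChange (frobSpec L p r)) = lamC ≫ DC.hat.mulN n ∧
      (∀ a, actC a ≫ c = c ≫ baseChangeHom (baseChangeHom (act a) x.left) (frobSpec L p r)) ∧
      (∀ i, AlgPoints.map c (P i) =
        AlgPoints.map (relFrobeniusOver p r (A.baseChange x.left).X :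
            (A.baseChange x.left).X ⟶ ((A.baseChange x.left).baseChange (frobSpec L p r)).X) (A.restrictPt x.left (τ i))) := by
  obtain ⟨J, hJ, hJlam, hJnat, hJsec⟩ := A.exists_frobeniusTwist_junction p r hq x hx''
  haveI := hJ
  refine ⟨u ≫ J.hom, inferInstance, fun a ha => ?_, fun T t => comp_kernel_iff_of_mono u J.hom K hker t, surjective_comp_left_base u J hsurj,
    comp_lam_comp_dualIsogenyOver_comp_of_exact DC (D.baseChange x''.left) ((D.baseChange x.left).baseChange (frobSpec L p r)) lamC
      (pol.baseChange x''.left).lam ((pol.baseChange x.left).baseChange (frobSpec L p r)).lam u J.hom n hlam (hJlam D pol),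
    fun a => ?_, fun i => ?_⟩
  · -- (f1): `d′ := J⁻¹ ≫ d`
    obtain ⟨d, hud, hdu⟩ := hpres a ha
    haveI := hact a
    refine ⟨J.inv ≫ d, ?_, ?_⟩
    · rw [Category.assoc, J.hom_inv_id_assoc, hud]
    · rw [Category.assoc, ← Category.assoc d, hdu, hJnat (act a), J.inv_hom_id_assoc]
  · haveI := hact a
    rw [← Category.assoc, hequiv a, Category.assoc, hJnat (act a), Category.assoc]
  · rw [AlgPoints.map_comp_apply, hsec i, hJsec (τ i)]

end PackagePresentation

end AbelianSchemeOver

end Literature.AlgebraicGeometry.AbelianSchemes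

end
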